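import Mathlib
import Literature.Analysis.FluidPDE.SuitableWeak
import Literature.Analysis.FluidPDE.Seregin2023.TypeIIEulerZoom
import Literature.Analysis.FluidPDE.LerayHopfProofs
import HarnessLib

/-!
# Time-window bookkeeping for the TIME-PERIODIC stratum of the crux
# `EulerZoomLiouville.PowerGaugeEulerLiouville` — tools

Route `EulerZoomLiouville` (NavierStokesRegularity), crux E = stmt-NavierStokesRegularity-19832
`PowerGaugeEulerLiouville` (Seregin's power-gauged ancient Euler class is trivial; OPEN on `0 < ρ ≤ 1/2`).
Companion of `EulerZoomLiouvillePowerGaugeEulerLiouvillePeriodic.lean` (the periodic stratum); this file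
holds the measure-theoretic bookkeeping, none of which mentions the Euler system:

* `const_slice_eq_zero_of_scaledLocalEnergyBound` — a slice `u t` (`t < 0`) which is a.e. constant is
  zero under the scaled local-energy bound `∫_{B(a)} |u(s)|² ≤ c a^{m₁}`, `s ∈ (−a², 0)` (`m₁ < 3`);
* `lintegral_window_ball_le_of_gaugeE` — `a^ρ E(a) ≤ c`, `R ≤ a` ⇒ `∫∫_{(−a²,0)×B_R} |H|²_F ≤ c a^{1−ρ}`;
* `lintegral_Ioo_shift` — `∫_{(α−s, β−s)} g = ∫_{(α,β)} g(· − s)`;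
* `mul_le_lintegral_of_period_windows` — equal masses `J` on the period windows `(−(k+1)P, −kP)` give
  `N · J ≤ ∫_{(−NP,0)} g`;
* `Iio_subset_iUnion_period_windows`, `lintegral_Iio_eq_zero_of_period_windows` — `(−∞,0)` is covered
  by the period windows and the (null) set of their endpoints;
* `setLIntegral_prod_eq` — Tonelli on a rectangle `I × B`.

WHAT THIS IS NOT: not NS — elementary real analysis. [folklore]
-/

noncomputable section

set_option linter.dupNamespace false

open MeasureTheory Set Filter Topology Metric Function TopologicalSpace
open scoped ENNReal NNReal InnerProductSpace RealInnerProductSpace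

namespace Summit.NavierStokesRegularity.NavierStokesRegularity.Theorems.PowerGaugeEulerLiouville

open Literature.Analysis Literature.Analysis.FunctionSpaces Literature.Analysis.FluidPDE

/-! ## Constant slices are killed by the scaled local-energy bound -/

/-- **A constant slice of a field with a scaled local-energy bound vanishes** (`m₁ < 3`): if
`∫_{B(0,a)} |u(s)|² ≤ c a^{m₁}` for `s ∈ (−a², 0)` and the slice `u t` (`t < 0`) is a.e. the constant
`b`, then `‖b‖² |B₁| a³ ≤ c a^{m₁}` for all `a > √(−t)`, forcing `b = 0`. [folklore] -/
theorem const_slice_eq_zero_of_scaledLocalEnergyBound {m₁ c : ℝ} (hm : m₁ < 3)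
    {u : ℝ → EuclideanSpace ℝ (Fin 3) → EuclideanSpace ℝ (Fin 3)}
    (hA : Seregin2023.HasScaledLocalEnergyBound m₁ c u) {t : ℝ} (ht : t < 0)
    {b : EuclideanSpace ℝ (Fin 3)} (hb : u t =ᵐ[volume] fun _ => b) : b = 0 := by
  by_contra hne
  set κ : ℝ≥0∞ := ‖b‖ₑ ^ 2 * volume (ball (0 : EuclideanSpace ℝ (Fin 3)) 1) with hκ
  have hκ0 : κ ≠ 0 :=
    mul_ne_zero (pow_ne_zero _ (by simpa using hne)) (measure_ball_pos volume _ one_pos).ne'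
  have hκtop : κ ≠ ⊤ := ENNReal.mul_ne_top (by simp) measure_ball_lt_top.ne
  -- for `a > √(-t)`: `κ · a³ ≤ c a^{m₁}`, i.e. `κ ≤ c a^{m₁ - 3}`
  have key : ∀ a : ℝ, Real.sqrt (-t) < a → κ ≤ ENNReal.ofReal (c * a ^ (m₁ - 3)) := by
    intro a ha
    have ha0 : 0 < a := lt_of_le_of_lt (Real.sqrt_nonneg _) ha
    have hs : t ∈ Ioo (-(a ^ 2)) 0 := by
      refine ⟨?_, ht⟩
      have h4 : Real.sqrt (-t) ^ 2 = -t := Real.sq_sqrt (by linarith)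
      nlinarith [Real.sqrt_nonneg (-t)]
    have h1 := hA a ha0 t hs
    have hint : ∫⁻ x in ball (0 : EuclideanSpace ℝ (Fin 3)) a, ‖u t x‖ₑ ^ 2 =
        κ * ENNReal.ofReal (a ^ 3) := by
      have h2 : ∫⁻ x in ball (0 : EuclideanSpace ℝ (Fin 3)) a, ‖u t x‖ₑ ^ 2 =
          ∫⁻ x in ball (0 : EuclideanSpace ℝ (Fin 3)) a, ‖b‖ₑ ^ 2 := by
        refine lintegral_congr_ae (ae_restrict_of_ae ?_)
        filter_upwards [hb] with x hx
        rw [hx]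
      rw [h2, lintegral_const, Measure.restrict_apply_univ, Measure.addHaar_ball_of_pos _ _ ha0,
        finrank_euclideanSpace_fin, hκ]
      ring
    rw [hint] at h1
    -- divide by `a³`
    have h3 : κ ≤ ENNReal.ofReal (c * a ^ m₁) / ENNReal.ofReal (a ^ 3) := by
      rw [ENNReal.le_div_iff_mul_le (Or.inl ((ENNReal.ofReal_pos.2 (by positivity)).ne'))
        (Or.inl ENNReal.ofReal_ne_top)]
      exact h1
    refine h3.trans (le_of_eq ?_)
    rw [← ENNReal.ofReal_div_of_pos (by positivity)]
    congr 1
    rw [mul_div_assoc, show (a ^ 3 : ℝ) = a ^ (3 : ℝ) by norm_cast, ← Real.rpow_sub ha0]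
  -- let `a → ∞`: the right side tends to `0`
  have hlim : Tendsto (fun a : ℝ => ENNReal.ofReal (c * a ^ (m₁ - 3))) atTop (𝓝 0) := by
    have h1 : Tendsto (fun a : ℝ => a ^ (m₁ - 3)) atTop (𝓝 0) := by
      have := tendsto_rpow_neg_atTop (y := 3 - m₁) (by linarith)
      refine this.congr fun a => ?_
      congr 1; ring
    have h2 := ENNReal.tendsto_ofReal (h1.const_mul c)
    rwa [mul_zero, ENNReal.ofReal_zero] at h2
  have hle : κ ≤ 0 :=
    ge_of_tendsto hlim ((eventually_gt_atTop (Real.sqrt (-t))).mono fun a ha => key a ha)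
  exact hκ0 (le_antisymm hle bot_le)

/-! ## The `E`-gauge on time windows, sliced in time -/

/-- **The `E`-gauge bounds the window integrals**: `a^ρ E(a) ≤ c`, `R ≤ a` ⇒
`∫∫_{(−a²,0)×B_R} |H|²_F ≤ c · a^{1−ρ}`. [folklore] -/
theorem lintegral_window_ball_le_of_gaugeE {ρ : ℝ}
    {H : ℝ → EuclideanSpace ℝ (Fin 3) → EuclideanSpace ℝ (Fin 3) →L[ℝ] EuclideanSpace ℝ (Fin 3)} {c : ℝ≥0}
    (hE : ∀ a : ℝ, 0 < a →
      ENNReal.ofReal (a ^ ρ) * cknE a (0 : ℝ × EuclideanSpace ℝ (Fin 3)) H ≤ (c : ℝ≥0∞))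
    {a R : ℝ} (ha : 0 < a) (hRa : R ≤ a) :
    ∫⁻ q in Ioo (-(a ^ 2)) 0 ×ˢ ball (0 : EuclideanSpace ℝ (Fin 3)) R,
        ENNReal.ofReal (frobeniusNormSq (H q.1 q.2)) ≤ ENNReal.ofReal (c * a ^ (1 - ρ)) := by
  have hsub : Ioo (-(a ^ 2)) 0 ×ˢ ball (0 : EuclideanSpace ℝ (Fin 3)) R ⊆
      parabolicCylinder a (0 : ℝ × EuclideanSpace ℝ (Fin 3)) := by
    intro q hq
    simp only [parabolicCylinder, mem_prod, mem_Ioo, mem_ball, Prod.fst_zero, Prod.snd_zero,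
      zero_sub] at hq ⊢
    exact ⟨hq.1, lt_of_lt_of_le hq.2 hRa⟩
  set J := ∫⁻ q in parabolicCylinder a (0 : ℝ × EuclideanSpace ℝ (Fin 3)),
    ENNReal.ofReal (frobeniusNormSq (H q.1 q.2)) with hJ
  have h1 := hE a ha
  have hEdef : cknE a (0 : ℝ × EuclideanSpace ℝ (Fin 3)) H = (ENNReal.ofReal a)⁻¹ * J := rfl
  rw [hEdef, ← mul_assoc] at h1
  have hpos : 0 < a ^ ρ * a⁻¹ := mul_pos (Real.rpow_pos_of_pos ha ρ) (inv_pos.2 ha)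
  have hcoef : ENNReal.ofReal (a ^ ρ) * (ENNReal.ofReal a)⁻¹ = ENNReal.ofReal (a ^ ρ * a⁻¹) := by
    rw [← ENNReal.ofReal_inv_of_pos ha, ← ENNReal.ofReal_mul (Real.rpow_nonneg ha.le _)]
  rw [hcoef] at h1
  have h2 : J ≤ (c : ℝ≥0∞) / ENNReal.ofReal (a ^ ρ * a⁻¹) := by
    rw [ENNReal.le_div_iff_mul_le (Or.inl ((ENNReal.ofReal_pos.2 hpos).ne')) (Or.inl ENNReal.ofReal_ne_top),
      mul_comm]
    exact h1
  refine (lintegral_mono_set hsub).trans (h2.trans (le_of_eq ?_))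
  rw [ENNReal.coe_nnreal_eq, ← ENNReal.ofReal_div_of_pos hpos]
  congr 1
  rw [div_eq_mul_inv, mul_inv, inv_inv, Real.rpow_sub ha, Real.rpow_one, div_eq_mul_inv]
  ring

/-! ## Time windows: shifts, period sums, and a cover of `(−∞, 0)` -/

/-- Shifting a time window: `∫_{(α−s, β−s)} g = ∫_{(α, β)} g(· − s)` (translation invariance of
Lebesgue measure on `ℝ`). [folklore] -/
theorem lintegral_Ioo_shift (g : ℝ → ℝ≥0∞) (α β s : ℝ) :
    ∫⁻ t in Ioo (α - s) (β - s), g t = ∫⁻ t in Ioo α β, g (t - s) := by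
  rw [← lintegral_indicator measurableSet_Ioo, ← lintegral_indicator measurableSet_Ioo,
    ← lintegral_sub_right_eq_self (fun t => (Ioo (α - s) (β - s)).indicator g t) s]
  congr 1
  funext t
  simp only [indicator, mem_Ioo, sub_lt_sub_iff_right]

/-- **Period sums.**  If every period window `(−(k+1)P, −kP)` carries the same mass `J`, then
`N · J ≤ ∫_{(−NP, 0)} g` for every `N`. [folklore] -/
theorem mul_le_lintegral_of_period_windows {g : ℝ → ℝ≥0∞} {P : ℝ} (hP : 0 < P) {J : ℝ≥0∞}
    (hJ : ∀ k : ℕ, ∫⁻ t in Ioo (-(((k : ℝ) + 1) * P)) (-((k : ℝ) * P)), g t = J) :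
    ∀ N : ℕ, (N : ℝ≥0∞) * J ≤ ∫⁻ t in Ioo (-((N : ℝ) * P)) 0, g t := by
  intro N
  induction N with
  | zero => simp
  | succ N ih =>
    have hdisj : Disjoint (Ioo (-(((N : ℝ) + 1) * P)) (-((N : ℝ) * P))) (Ioo (-((N : ℝ) * P)) 0) := by
      rw [Set.disjoint_iff]
      rintro t ⟨h1, h2⟩
      exact (lt_irrefl _ (h1.2.trans h2.1)).elim
    have hsub : Ioo (-(((N : ℝ) + 1) * P)) (-((N : ℝ) * P)) ∪ Ioo (-((N : ℝ) * P)) 0 ⊆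
        Ioo (-((((N + 1 : ℕ)) : ℝ) * P)) 0 := by
      rintro t (⟨h1, h2⟩ | ⟨h1, h2⟩)
      · refine ⟨by push_cast; linarith, lt_of_lt_of_le h2 ?_⟩
        have : 0 ≤ (N : ℝ) * P := by positivity
        linarith
      · exact ⟨by push_cast; nlinarith, h2⟩
    calc (((N + 1 : ℕ)) : ℝ≥0∞) * J = J + (N : ℝ≥0∞) * J := by push_cast; ring
      _ ≤ (∫⁻ t in Ioo (-(((N : ℝ) + 1) * P)) (-((N : ℝ) * P)), g t) +
            ∫⁻ t in Ioo (-((N : ℝ) * P)) 0, g t := by rw [hJ N]; exact add_le_add le_rfl ih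
      _ = ∫⁻ t in Ioo (-(((N : ℝ) + 1) * P)) (-((N : ℝ) * P)) ∪ Ioo (-((N : ℝ) * P)) 0, g t :=
            (lintegral_union measurableSet_Ioo hdisj).symm
      _ ≤ ∫⁻ t in Ioo (-((((N + 1 : ℕ)) : ℝ) * P)) 0, g t := lintegral_mono_set hsub

/-- `(−∞, 0)` is covered by the period windows `(−(k+1)P, −kP)` and the countably many endpoints
`−(k+1)P`. [folklore] -/
theorem Iio_subset_iUnion_period_windows {P : ℝ} (hP : 0 < P) :
    Iio (0 : ℝ) ⊆ (⋃ k : ℕ, Ioo (-(((k : ℝ) + 1) * P)) (-((k : ℝ) * P))) ∪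
      Set.range (fun k : ℕ => -(((k : ℝ) + 1) * P)) := by
  intro t ht
  have ht' : 0 < -t / P := div_pos (by simpa using ht) hP
  set m : ℕ := ⌈-t / P⌉₊ with hm
  have hm1 : 1 ≤ m := Nat.one_le_iff_ne_zero.2 (by
    rw [hm]; exact (Nat.ceil_pos.2 ht').ne')
  have hle : -t / P ≤ (m : ℝ) := Nat.le_ceil _
  have hlt : (m : ℝ) < -t / P + 1 := Nat.ceil_lt_add_one ht'.le
  -- `m - 1 < -t/P ≤ m`, i.e. `-mP ≤ t < -(m-1)P`
  obtain ⟨k, hk⟩ : ∃ k : ℕ, m = k + 1 := ⟨m - 1, by omega⟩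
  have hkm : (m : ℝ) = (k : ℝ) + 1 := by rw [hk]; push_cast; ring
  rw [hkm] at hle hlt
  have e1 : -(((k : ℝ) + 1) * P) ≤ t := by
    have : -t ≤ ((k : ℝ) + 1) * P := by rwa [div_le_iff₀ hP] at hle
    linarith
  have e2 : t < -((k : ℝ) * P) := by
    have h3 : (k : ℝ) < -t / P := by linarith
    rw [lt_div_iff₀ hP] at h3
    linarith
  rcases e1.eq_or_lt with h | h
  · exact Or.inr ⟨k, h⟩
  · exact Or.inl (mem_iUnion.2 ⟨k, ⟨h, e2⟩⟩)

/-- The set of period endpoints is Lebesgue-null, so a function integrating to zero on every period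
window integrates to zero on `(−∞, 0)`. [folklore] -/
theorem lintegral_Iio_eq_zero_of_period_windows {g : ℝ → ℝ≥0∞} {P : ℝ} (hP : 0 < P)
    (hJ : ∀ k : ℕ, ∫⁻ t in Ioo (-(((k : ℝ) + 1) * P)) (-((k : ℝ) * P)), g t = 0) :
    ∫⁻ t in Iio (0 : ℝ), g t = 0 := by
  have hS : volume (Set.range (fun k : ℕ => -(((k : ℝ) + 1) * P))) = 0 :=
    (Set.countable_range _).measure_zero volume
  have hU : ∫⁻ t in (⋃ k : ℕ, Ioo (-(((k : ℝ) + 1) * P)) (-((k : ℝ) * P))), g t = 0 := by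
    refine le_antisymm ((lintegral_iUnion_le _ _).trans ?_) bot_le
    simp [hJ]
  refine le_antisymm ?_ bot_le
  calc ∫⁻ t in Iio (0 : ℝ), g t
      ≤ ∫⁻ t in (⋃ k : ℕ, Ioo (-(((k : ℝ) + 1) * P)) (-((k : ℝ) * P))) ∪
          Set.range (fun k : ℕ => -(((k : ℝ) + 1) * P)), g t :=
        lintegral_mono_set (Iio_subset_iUnion_period_windows hP)
    _ ≤ (∫⁻ t in (⋃ k : ℕ, Ioo (-(((k : ℝ) + 1) * P)) (-((k : ℝ) * P))), g t) +
          ∫⁻ t in Set.range (fun k : ℕ => -(((k : ℝ) + 1) * P)), g t := lintegral_union_le _ _ _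
    _ = 0 := by rw [hU, setLIntegral_measure_zero _ _ hS, add_zero]

/-! ## Tonelli on time windows -/

/-- Tonelli on a rectangle `I × B`: `∫∫_{I×B} F = ∫_{t∈I} ∫_{x∈B} F(t,x)`. [folklore] -/
theorem setLIntegral_prod_eq {F : ℝ × EuclideanSpace ℝ (Fin 3) → ℝ≥0∞} {I : Set ℝ}
    {B : Set (EuclideanSpace ℝ (Fin 3))}
    (hF : AEMeasurable F (volume.restrict (I ×ˢ B))) :
    ∫⁻ q in I ×ˢ B, F q = ∫⁻ t in I, ∫⁻ x in B, F (t, x) := by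
  have hμ : (volume : Measure (ℝ × EuclideanSpace ℝ (Fin 3))).restrict (I ×ˢ B) =
      (volume.restrict I).prod (volume.restrict B) := by
    rw [Measure.volume_eq_prod, Measure.prod_restrict]
  rw [hμ] at hF ⊢
  rw [lintegral_prod _ hF]

end Summit.NavierStokesRegularity.NavierStokesRegularity.Theorems.PowerGaugeEulerLiouville

end
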